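import Summits.RiemannHypothesis.RiemannHypothesis.Theorems.TiltedLandingLaw421R2NodeDR

/-!
# TiltedLandingLaw421 — round 2R: the keyed stub `ZRestTrkDHFR′` READ OFF (C4 «kernel desk» §K.15, rh-idea-6 g25 — HELPER IMAGE for the β′ᴿ hand,
(CA322) «land the read-off as your helper 1»; files-only cell: NOT proposed by C4.  Typed ≠ proved; nothing here bears on the truth of RH; RH is NOT proved.)

For EVERY meter `M`, the truncated-settler REST `RestBudgetGF μ P St Ready 𝓔 (sigmaMin … M) (heightBudget M St) M` is EQUIVALENT to
`FlatRestGM μ P St Ready 𝓔 M` = per `EngineHyps5 2` frame, ONE toll witness `lam` (`−μ s ≤ lam j`, successor clause at charged levels) with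
  (F) `∀ k, injected … k + Σ_{j<k}[Charged j] (𝟙_𝓔 j + lam j /(μ s)) ≤ (Hs/s)² + B + 1 + 4 (hmax − rootHeight St …)/s`   (flat REST: meter-free), and
  (C) `∀ k, injected … k < M … 0 → M … 0 + (the same Σ) ≤ (the same purse)`                                      (meter clause).
(`restBudgetGF_min_iff`; the proof is `max (injected − M 0) 0 + Σ ≤ purse − M 0` split on the `max`.)
Instances: ★ `zRestTrkDHFR'_iff_flatM` — the KEYED stub (CA316/CA322) `RhW08.Round2.ZRestTrkDHFR'` with `M = RhW08.Round1.tentMeterTrkD (3/2)` (T₀ᴿ at `k = 0`);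
`zRestTrkDHF'_iff_flatM` — the archived `ZRestTrkDHF'` (`M = tentMeterMax (3/2)`; C6 ADD-79 kills its clause (C) at `k = 0`);
`tentTrkD_le_of_zRestTrkDHFR'` — (C) at `k = 0`: `T₀ᴿ ≤ purse`; `law421T_of_flatMR` — the node of record through the read-off form.
-/

namespace RhW08.StSwap

open RhIdea6.G17.W07C7 RhIdea6.G17.W07C7.Rev6 RhIdea6.G18.W07C8.Law421BirthS RhIdea6.G19.W07C11.Seam
open RhIdea6.G20.W07C12.Frac RhIdea6.G20.W07C12.StColP RhW07.C12.FieldSplit RhIdea6.G21.W07C13.TentMax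
open RhW07.C14.TwoSided RhW07.C14.Classes RhW07.C14.Lineage RhW07.C14.Booking
open RhW07.C13.Heredity RhIdea6.G22.W07C15pre.Injection RhW07.E3.Cell RhW07.E3.Lit

section MeterClause

open Classical in
/-- ★★ flat REST ∧ METER CLAUSE with one shared toll witness (the truncated twin, read off). -/
def FlatRestGM (μ : ℝ) (P St Ready : StatePred) (𝓔 : LevelClass) (M : LevelMeter) : Prop :=
  ∀ (η : ℝ) (f : ℂ → ℂ) (x₀ s hmax R Hs : ℝ) (B : ℕ), EngineHyps5 2 η f x₀ s hmax R Hs B →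
    ∃ lam : ℕ → ℝ, (∀ j : ℕ, -(μ * s) ≤ lam j) ∧
      (∀ j : ℕ, Charged P St Ready η f x₀ s hmax R Hs B j →
        ∀ u : ℂ, St η f x₀ s hmax R Hs B j u → ¬ Ready η f x₀ s hmax R Hs B j u →
          ∃ u' : ℂ, St η f x₀ s hmax R Hs B (j + 1) u' ∧ |u'.im| ≤ |u.im| + lam j) ∧
      (∀ k : ℕ, injected P St Ready 𝓔 η f x₀ s hmax R Hs B k
          + (∑ j ∈ Finset.range k, (if Charged P St Ready η f x₀ s hmax R Hs B j then
              (if 𝓔 η f x₀ s hmax R Hs B j then (1 : ℝ) else 0) + lam j / (μ * s) else 0))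
        ≤ (Hs / s) ^ 2 + (B : ℝ) + 1 + 4 * (hmax - rootHeight St η f x₀ s hmax R Hs B) / s) ∧
      (∀ k : ℕ, injected P St Ready 𝓔 η f x₀ s hmax R Hs B k < M η f x₀ s hmax R Hs B 0 →
        M η f x₀ s hmax R Hs B 0
          + (∑ j ∈ Finset.range k, (if Charged P St Ready η f x₀ s hmax R Hs B j then
              (if 𝓔 η f x₀ s hmax R Hs B j then (1 : ℝ) else 0) + lam j / (μ * s) else 0))
        ≤ (Hs / s) ^ 2 + (B : ℝ) + 1 + 4 * (hmax - rootHeight St η f x₀ s hmax R Hs B) / s)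

/-- ★★★ (K) **THE TRUNCATED TWIN READ OFF**, for every meter: `(injected − M 0)⁺`-settler × purse `heightBudget M` ⟺ flat REST ∧ meter clause (shared tolls). -/
theorem restBudgetGF_min_iff (μ : ℝ) (P St Ready : StatePred) (𝓔 : LevelClass) (M : LevelMeter) :
    RhW08.Round2.RestBudgetGF μ P St Ready 𝓔 (RhW07.E3.Cell.sigmaMin P St Ready 𝓔 M) (heightBudget M St) M ↔ FlatRestGM μ P St Ready 𝓔 M := by
  constructor
  · intro h η f x₀ s hmax R Hs B hE
    obtain ⟨lam, hL, hS, hB⟩ := h η f x₀ s hmax R Hs B hE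
    refine ⟨lam, hL, hS, fun k => ?_, fun k hk => ?_⟩
    · have h1 := hB k
      simp only [RhW07.E3.Cell.sigmaMin, heightBudget] at h1
      have h2 := le_max_left (injected P St Ready 𝓔 η f x₀ s hmax R Hs B k - M η f x₀ s hmax R Hs B 0) 0
      linarith
    · have h1 := hB k
      simp only [RhW07.E3.Cell.sigmaMin, heightBudget] at h1
      have h2 := le_max_right (injected P St Ready 𝓔 η f x₀ s hmax R Hs B k - M η f x₀ s hmax R Hs B 0) 0
      linarith
  · intro h η f x₀ s hmax R Hs B hE
    obtain ⟨lam, hL, hS, hF, hC⟩ := h η f x₀ s hmax R Hs B hE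
    refine ⟨lam, hL, hS, fun k => ?_⟩
    simp only [RhW07.E3.Cell.sigmaMin, heightBudget]
    by_cases hk : injected P St Ready 𝓔 η f x₀ s hmax R Hs B k < M η f x₀ s hmax R Hs B 0
    · have h1 := hC k hk
      rw [max_eq_right (by linarith)]
      linarith
    · have h1 := hF k
      rw [max_eq_left (by linarith)]
      linarith

open Classical in
/-- (K) the clause WITHOUT its guard follows (when `M 0 ≤ injected k` it is dominated by the flat line) — so the guard only records WHERE the clause can bind. -/
theorem meterClause_unguarded {μ : ℝ} {P St Ready : StatePred} {𝓔 : LevelClass} {M : LevelMeter} (h : FlatRestGM μ P St Ready 𝓔 M)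
    (η : ℝ) (f : ℂ → ℂ) (x₀ s hmax R Hs : ℝ) (B : ℕ) (hE : EngineHyps5 2 η f x₀ s hmax R Hs B) :
    ∃ lam : ℕ → ℝ, (∀ j : ℕ, -(μ * s) ≤ lam j) ∧
      ∀ k : ℕ, M η f x₀ s hmax R Hs B 0
          + (∑ j ∈ Finset.range k, (if Charged P St Ready η f x₀ s hmax R Hs B j then
              (if 𝓔 η f x₀ s hmax R Hs B j then (1 : ℝ) else 0) + lam j / (μ * s) else 0))
        ≤ (Hs / s) ^ 2 + (B : ℝ) + 1 + 4 * (hmax - rootHeight St η f x₀ s hmax R Hs B) / s := by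
  obtain ⟨lam, hL, _, hF, hC⟩ := h η f x₀ s hmax R Hs B hE
  refine ⟨lam, hL, fun k => ?_⟩
  by_cases hk : injected P St Ready 𝓔 η f x₀ s hmax R Hs B k < M η f x₀ s hmax R Hs B 0
  · exact hC k hk
  · have h1 := hF k
    have h2 := not_lt.mp hk
    linarith

/-- ★★★ (K, the KEYED stub read off; (CA316)/(CA322)) `ZRestTrkDHFR′` ⟺ flat REST (class `EmptyTrkD`) ∧ the T₀ᴿ-clause, ONE toll witness
(`M = RhW08.Round1.tentMeterTrkD (3/2)`, the 3/2-tent of the lowest TRACKED root). -/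
theorem zRestTrkDHFR'_iff_flatM :
    RhW08.Round2.ZRestTrkDHFR' ↔
      FlatRestGM (1 / 4) RhW08.Round1.PTrkD RhW08.Round1.StTrkD ReadyR2 RhW08.Round1.EmptyTrkD (RhW08.Round1.tentMeterTrkD (3 / 2)) :=
  restBudgetGF_min_iff (1 / 4) RhW08.Round1.PTrkD RhW08.Round1.StTrkD ReadyR2 RhW08.Round1.EmptyTrkD (RhW08.Round1.tentMeterTrkD (3 / 2))

/-- ★★ (K) the node of record through the read-off form: (F) ∧ (C) for the tracked-root meter, and the α seal, give the crux
(= `RhW08.R2Node.law421T_of_round2DFR` after `zRestTrkDHFR'_iff_flatM`). -/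
theorem law421T_of_flatMR
    (h : FlatRestGM (1 / 4) RhW08.Round1.PTrkD RhW08.Round1.StTrkD ReadyR2 RhW08.Round1.EmptyTrkD (RhW08.Round1.tentMeterTrkD (3 / 2)))
    (hα : RhW08.Round2.AlphaSealTrkD') :
    Summit.RiemannHypothesis.RiemannHypothesis.Theses.EarlyAppointments.TiltedLandingLaw421 :=
  RhW08.R2Node.law421T_of_round2DFR (zRestTrkDHFR'_iff_flatM.2 h) hα

/-- (K1ᴿ) the clause (C) at `k = 0` — what the keyed stub says before any level is charged: `T₀ᴿ ≤ (Hs/s)² + B + 1 + 4 (hmax − rootHeight StTrkD)/s`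
(C6 ADD-80 (ii) / C1 WORDS-47R INIT♯: forced by the column budget at the tracked root — a lemma for the hand, here only READ OFF the stub). -/
theorem tentTrkD_le_of_zRestTrkDHFR' (h : RhW08.Round2.ZRestTrkDHFR') (η : ℝ) (f : ℂ → ℂ) (x₀ s hmax R Hs : ℝ) (B : ℕ)
    (hE : EngineHyps5 2 η f x₀ s hmax R Hs B) :
    RhW08.Round1.tentMeterTrkD (3 / 2) η f x₀ s hmax R Hs B 0
      ≤ (Hs / s) ^ 2 + (B : ℝ) + 1 + 4 * (hmax - rootHeight RhW08.Round1.StTrkD η f x₀ s hmax R Hs B) / s := by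
  obtain ⟨lam, -, -, hB⟩ := h η f x₀ s hmax R Hs B hE
  have h0 := hB 0
  simp only [Finset.sum_range_zero, add_zero] at h0
  have h1 : (0 : ℝ) ≤ RhW08.Round2.SigmaMinTrkDR' η f x₀ s hmax R Hs B 0 := le_max_right _ _
  simp only [heightBudget] at h0
  linarith

/-- ★★ (K, D-instance) the KILLED stub read off: `ZRestTrkDHF′` ⟺ flat REST (class `EmptyTrkD`) ∧ the T₀-clause (`T₀ = tentMeterMax (3/2) … 0`, the far 3/2-tent). -/
theorem zRestTrkDHF'_iff_flatM :
    RhW08.Round2.ZRestTrkDHF' ↔ FlatRestGM (1 / 4) RhW08.Round1.PTrkD RhW08.Round1.StTrkD ReadyR2 RhW08.Round1.EmptyTrkD (tentMeterMax (3 / 2)) :=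
  restBudgetGF_min_iff (1 / 4) RhW08.Round1.PTrkD RhW08.Round1.StTrkD ReadyR2 RhW08.Round1.EmptyTrkD (tentMeterMax (3 / 2))

end MeterClause

end RhW08.StSwap
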